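import Summits.ABC.ABC.Theorems.CuspFieldPencilGoldenFromNFPencil
import Literature.NumberTheory.DiophantineGeometry.MatveevYuPlaceBoundsNumberField
import Literature.NumberTheory.DiophantineGeometry.AbcTwoAdicValuationProofs
import Literature.NumberTheory.DiophantineGeometry.PastenSubexpDecomposition
import Literature.NumberTheory.EllipticCurves.HeightsBaseChangeProofs
import Literature.IUT.LogVolume.ArakelovDivisors
import HarnessLib

/-!
# STUB-IDEAS `stub_conjugateCuspTriple` — ideator k=2, GEN 6 (FAMILY 2: RESHAPE) — Sketch

Crux `GoldenCuspShadow` (stmt-ABC-26026), route `CuspFieldPencil`.  `Q = u² − 11uw − w²`,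
`R = rad(uwQ) = rad u · rad w · rad Q`, `H = max(|u|,|w|)`, `m = min(rad u, rad w)`, `q = rad Q`.

GEN-6 STATUS (tree + crux dir, 2026-08-31T19:2xZ).  `UWHalf` (`log H ≤ κ_ε R^ε · m`) is now
KERNEL-CLOSED, sorry-free, UNCONDITIONALLY, in the committed crux-dir sketch
`LANDING_monolith_GoldenCuspShadow_nodef.lean` (`GoldenCuspShadowBaker.cuspMinRadBound_holds`, k1-g5)
and in `STUB_IDEAS_stub_splitCuspTriple_3_g5_Sketch.lean`; with it the whole crux (exponent 1/2).
Hence, by the PROVED cover step `SideaK2G5.stub_of_uwHalf_qSideRadSq`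
(`min(m,q²) ≤ m^{2/3}(q²)^{1/3}`), **the registered stub's entire remaining content is the
member-local K-side datum `QSideRadSq`** (`log H ≤ κ_δ R^δ q²`).

GEN-6 RESHAPE, two moves:
* (T1, weaken-and-bootstrap) prove `QSideRadSq` with the CRUDE place cost (`N𝔭 ≤ p^2`) first —
  it already upgrades the class exponent `1/2 → 2/5` (`twoFifths_of_uwHalf_qSideRadSq`, PROVED
  below); bootstrap to the FINE datum `QSideRad` (`q¹`; one Dedekind lemma `splitPlace`, `N𝔭 = p`
  for `p ∣ Q`, `p ≠ 5`) for exponent `1/3` (`third_of_uwHalf_qSideRad`, PROVED below).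
* (T2, strengthen-to-simplify the load-bearing helper) g5's ONE instantiation lemma H2
  `memberBound` is cut into XS/S pieces by porting the tree's ℚ template
  `Pasten.approx_generic` / `cast_div_eq_prod_zpow` to `K`: the explicit generator family
  `famα/famb` on `Option (Option ↥T)`, `T = primeFactors(|u||v|)` (G0–G6 below), so that H2 is a
  plain unpacking of `NFPlaceBound K` (EG2022 Prop. 4.2.4 pair, PROVED in the tree from the named
  facts `matveev2000_linearFormsLog_nf`, `yu2007_padicLogForm_logB_nf`).

Kernel status of THIS file (`lean check --json`, farm, 2026-08-31): rc 0, 5 `sorry`s = exactly the OPEN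
helpers G3 `member_eq_famProd`, G4 `expBound`, G5 `heightProduct`, H2' `memberBound`, F1 `splitPlace`;
PROVED here: `cover_step`, `twoFifths_of_uwHalf_qSideRadSq`, `third_of_uwHalf_qSideRad`, G0a/G0b,
G1 `famProd`, G2 `castFamily`, G5a `logHeight₁_natCast_nf`, G6 `log_adicAbv_eq` (+ g5's `min_le_geom`,
`radR_prod`).
-/

set_option linter.dupNamespace false

noncomputable section

open Real NumberField UniqueFactorizationMonoid Height IsDedekindDomain Finset
open Literature.NumberTheory.DiophantineGeometry
open Literature.NumberTheory.DiophantineGeometry.Dioph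
open Literature.IUT.LogVolume

namespace Summit.ABC.ABC.Cruxes.GoldenCuspShadow.SideaK2G6

/-! ## §0 Statements (verbatim copies of g5 `SideaK2G5` + the two payoff statements) -/

/-- The registered stub `stub_conjugateCuspTriple`, verbatim. -/
def StubConjugate : Prop :=
  ∀ ε : ℝ, 0 < ε → ∃ κ : ℝ, ∀ u w : ℤ, IsCoprime u w → u * w * (u ^ 2 - 11 * u * w - w ^ 2) ≠ 0 →
    Real.log (max (|(u : ℝ)|) (|(w : ℝ)|)) ≤
      κ * (((UniqueFactorizationMonoid.radical (u * w * (u ^ 2 - 11 * u * w - w ^ 2))).natAbs : ℕ) : ℝ) ^ (ε : ℝ) *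
        ((((UniqueFactorizationMonoid.radical (u ^ 2 - 11 * u * w - w ^ 2)).natAbs : ℕ) : ℝ) ^ (2 / 3 : ℝ) *
          (min (((UniqueFactorizationMonoid.radical u).natAbs : ℕ) : ℝ)
              (((UniqueFactorizationMonoid.radical w).natAbs : ℕ) : ℝ)) ^ (2 / 3 : ℝ))

/-- ℚ-engine output, KERNEL-CLOSED unconditionally (`GoldenCuspShadowBaker.cuspMinRadBound_holds`,
crux-dir monolith; same term up to the binder name `ε`/`δ`): `log H ≤ κ_δ R^δ · min(rad u, rad w)`. -/
def UWHalf : Prop :=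
  ∀ δ : ℝ, 0 < δ → ∃ κ : ℝ, ∀ u w : ℤ, IsCoprime u w → u * w * (u ^ 2 - 11 * u * w - w ^ 2) ≠ 0 →
    Real.log (max (|(u : ℝ)|) (|(w : ℝ)|)) ≤
      κ * (((radical (u * w * (u ^ 2 - 11 * u * w - w ^ 2))).natAbs : ℕ) : ℝ) ^ (δ : ℝ) *
        min (((radical u).natAbs : ℕ) : ℝ) (((radical w).natAbs : ℕ) : ℝ)

/-- CRUDE K-datum (all the stub needs): `log H ≤ κ_δ R^δ · rad(Q)²`. -/
def QSideRadSq : Prop :=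
  ∀ δ : ℝ, 0 < δ → ∃ κ : ℝ, ∀ u w : ℤ, IsCoprime u w → u * w * (u ^ 2 - 11 * u * w - w ^ 2) ≠ 0 →
    Real.log (max (|(u : ℝ)|) (|(w : ℝ)|)) ≤
      κ * (((radical (u * w * (u ^ 2 - 11 * u * w - w ^ 2))).natAbs : ℕ) : ℝ) ^ (δ : ℝ) *
        (((radical (u ^ 2 - 11 * u * w - w ^ 2)).natAbs : ℕ) : ℝ) ^ 2

/-- FINE K-datum (bootstrap target; k3-g3 `QSideRad`): `log H ≤ κ_δ R^δ · rad(Q)`. -/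
def QSideRad : Prop :=
  ∀ δ : ℝ, 0 < δ → ∃ κ : ℝ, ∀ u w : ℤ, IsCoprime u w → u * w * (u ^ 2 - 11 * u * w - w ^ 2) ≠ 0 →
    Real.log (max (|(u : ℝ)|) (|(w : ℝ)|)) ≤
      κ * (((radical (u * w * (u ^ 2 - 11 * u * w - w ^ 2))).natAbs : ℕ) : ℝ) ^ (δ : ℝ) *
        (((radical (u ^ 2 - 11 * u * w - w ^ 2)).natAbs : ℕ) : ℝ)

/-- Route payoff, crude road: the crux with exponent `2/5` in place of `1/2`. -/
def GoldenTwoFifths : Prop :=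
  ∀ ε : ℝ, 0 < ε → ∃ κ : ℝ, ∀ u w : ℤ, IsCoprime u w → u * w * (u ^ 2 - 11 * u * w - w ^ 2) ≠ 0 →
    Real.log (max (|(u : ℝ)|) (|(w : ℝ)|)) ≤
      κ * (((radical (u * w * (u ^ 2 - 11 * u * w - w ^ 2))).natAbs : ℕ) : ℝ) ^ (2 / 5 + ε : ℝ)

/-- Route payoff, fine road: exponent `1/3` (k3-g3 `GoldenThird`). -/
def GoldenThird : Prop :=
  ∀ ε : ℝ, 0 < ε → ∃ κ : ℝ, ∀ u w : ℤ, IsCoprime u w → u * w * (u ^ 2 - 11 * u * w - w ^ 2) ≠ 0 →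
    Real.log (max (|(u : ℝ)|) (|(w : ℝ)|)) ≤
      κ * (((radical (u * w * (u ^ 2 - 11 * u * w - w ^ 2))).natAbs : ℕ) : ℝ) ^ (1 / 3 + ε : ℝ)

/-! ## §1 Payoff glue (why the K-side is worth landing even after the crux closes) -/

/-- `min a b ≤ a^s b^t` for `s + t = 1` (g5, PROVED). -/
theorem min_le_geom {a b s t : ℝ} (ha : 0 ≤ a) (hb : 0 ≤ b) (hs : 0 ≤ s) (ht : 0 ≤ t)
    (hst : s + t = 1) : min a b ≤ a ^ s * b ^ t := by
  have hm0 : 0 ≤ min a b := le_min ha hb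
  have hsplit : min a b = (min a b) ^ s * (min a b) ^ t := by
    rw [← Real.rpow_add' hm0 (by rw [hst]; norm_num), hst, Real.rpow_one]
  rw [hsplit]
  exact mul_le_mul (Real.rpow_le_rpow hm0 (min_le_left a b) hs)
    (Real.rpow_le_rpow hm0 (min_le_right a b) ht) (Real.rpow_nonneg hm0 t) (Real.rpow_nonneg ha s)

/-- The radical product as reals: `R = rad u · rad w · rad Q` (tree `GoldenFromNFPencil.natAbs_radical_prod`). -/
theorem radR_prod {u w : ℤ} (h : IsCoprime u w) :
    (((radical (u * w * (u ^ 2 - 11 * u * w - w ^ 2))).natAbs : ℕ) : ℝ) =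
      (((radical u).natAbs : ℕ) : ℝ) * (((radical w).natAbs : ℕ) : ℝ) *
        (((radical (u ^ 2 - 11 * u * w - w ^ 2)).natAbs : ℕ) : ℝ) := by
  rw [Summit.ABC.ABC.Theorems.GoldenFromNFPencil.natAbs_radical_prod h]; push_cast; ring

/-- Generic two-reading lemma: from `L ≤ κ₁ R^ε m` and `L ≤ κ₂ R^ε q^c` with `m² q ≤ R`-type control
packaged as `min m (q^c) ≤ R^θ`, conclude `L ≤ κ R^(θ+ε)`. -/
theorem cover_step {L R m Q ε θ κ₁ κ₂ : ℝ} (hR : 0 ≤ R) (hm : 0 ≤ m) (hQ : 0 ≤ Q)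
    (hθε : 0 < θ + ε)
    (hA : L ≤ κ₁ * R ^ (ε : ℝ) * m) (hB : L ≤ κ₂ * R ^ (ε : ℝ) * Q) (hmin : min m Q ≤ R ^ θ) :
    L ≤ max (max κ₁ κ₂) 0 * R ^ (θ + ε : ℝ) := by
  set κ : ℝ := max (max κ₁ κ₂) 0 with hκ
  have hκ0 : 0 ≤ κ := le_max_right _ _
  have hRe : 0 ≤ R ^ (ε : ℝ) := Real.rpow_nonneg hR _
  have hκR : 0 ≤ κ * R ^ (ε : ℝ) := mul_nonneg hκ0 hRe
  have hA' : L ≤ κ * R ^ (ε : ℝ) * m :=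
    hA.trans (mul_le_mul_of_nonneg_right
      (mul_le_mul_of_nonneg_right ((le_max_left κ₁ κ₂).trans (le_max_left _ 0)) hRe) hm)
  have hB' : L ≤ κ * R ^ (ε : ℝ) * Q :=
    hB.trans (mul_le_mul_of_nonneg_right
      (mul_le_mul_of_nonneg_right ((le_max_right κ₁ κ₂).trans (le_max_left _ 0)) hRe) hQ)
  have hmin' : L ≤ κ * R ^ (ε : ℝ) * min m Q := by
    rcases le_total m Q with h | h
    · rw [min_eq_left h]; exact hA'
    · rw [min_eq_right h]; exact hB'
  calc L ≤ κ * R ^ (ε : ℝ) * min m Q := hmin'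
    _ ≤ κ * R ^ (ε : ℝ) * R ^ θ := mul_le_mul_of_nonneg_left hmin hκR
    _ = κ * R ^ (θ + ε : ℝ) := by
        rw [mul_assoc, ← Real.rpow_add' hR (by linarith), add_comm]

/-- **Payoff of the crude road (PROVED): `UWHalf ∧ QSideRadSq ⇒ exponent 2/5`**, via
`min(m, q²) ≤ m^{4/5}(q²)^{1/5} = (m⁴q²)^{1/5} ≤ ((rad u·rad w·q)²)^{1/5} = R^{2/5}`. -/
theorem twoFifths_of_uwHalf_qSideRadSq (h1 : UWHalf) (h2 : QSideRadSq) : GoldenTwoFifths := by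
  intro ε hε
  obtain ⟨κ₁, hκ₁⟩ := h1 ε hε
  obtain ⟨κ₂, hκ₂⟩ := h2 ε hε
  refine ⟨max (max κ₁ κ₂) 0, fun u w huw h0 => ?_⟩
  have hA := hκ₁ u w huw h0
  have hB := hκ₂ u w huw h0
  have hRabq := radR_prod huw
  generalize hR : (((radical (u * w * (u ^ 2 - 11 * u * w - w ^ 2))).natAbs : ℕ) : ℝ) = R at *
  generalize hq : (((radical (u ^ 2 - 11 * u * w - w ^ 2)).natAbs : ℕ) : ℝ) = q at *
  generalize ha : (((radical u).natAbs : ℕ) : ℝ) = a at *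
  generalize hb : (((radical w).natAbs : ℕ) : ℝ) = b at *
  generalize hL : Real.log (max (|(u : ℝ)|) (|(w : ℝ)|)) = L at *
  have hq0 : 0 ≤ q := by rw [← hq]; exact Nat.cast_nonneg _
  have ha0 : 0 ≤ a := by rw [← ha]; exact Nat.cast_nonneg _
  have hb0 : 0 ≤ b := by rw [← hb]; exact Nat.cast_nonneg _
  have hR0 : 0 ≤ R := by rw [hRabq]; positivity
  have hm0 : 0 ≤ min a b := le_min ha0 hb0
  refine cover_step hR0 hm0 (by positivity) (by linarith) hA hB ?_
  -- `min (min a b) (q²) ≤ R^{2/5}`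
  have hgeom : min (min a b) (q ^ 2) ≤ (min a b) ^ (4 / 5 : ℝ) * (q ^ 2) ^ (1 / 5 : ℝ) :=
    min_le_geom hm0 (by positivity) (by norm_num) (by norm_num) (by norm_num)
  have hm2 : (min a b) ^ (2 : ℕ) ≤ a * b := by
    rw [pow_two]
    exact mul_le_mul (min_le_left a b) (min_le_right a b) hm0 ha0
  have h1' : (min a b) ^ (4 / 5 : ℝ) ≤ (a * b) ^ (2 / 5 : ℝ) := by
    have : (min a b) ^ (4 / 5 : ℝ) = ((min a b) ^ (2 : ℕ)) ^ (2 / 5 : ℝ) := by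
      rw [show ((min a b) ^ (2 : ℕ) : ℝ) = (min a b) ^ (2 : ℝ) by norm_cast, ← Real.rpow_mul hm0]
      norm_num
    rw [this]
    exact Real.rpow_le_rpow (by positivity) hm2 (by norm_num)
  have h2' : (q ^ 2) ^ (1 / 5 : ℝ) = q ^ (2 / 5 : ℝ) := by
    rw [show (q ^ 2 : ℝ) = q ^ (2 : ℝ) by norm_cast, ← Real.rpow_mul hq0]; norm_num
  calc min (min a b) (q ^ 2) ≤ (min a b) ^ (4 / 5 : ℝ) * (q ^ 2) ^ (1 / 5 : ℝ) := hgeom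
    _ ≤ (a * b) ^ (2 / 5 : ℝ) * q ^ (2 / 5 : ℝ) := by
        rw [h2']
        exact mul_le_mul_of_nonneg_right h1' (Real.rpow_nonneg hq0 _)
    _ = R ^ (2 / 5 : ℝ) := by rw [← Real.mul_rpow (by positivity) hq0, hRabq]

/-- **Payoff of the fine road (PROVED): `UWHalf ∧ QSideRad ⇒ exponent 1/3`**, via
`min(m, q) ≤ m^{2/3} q^{1/3} ≤ (rad u·rad w·q)^{1/3} = R^{1/3}`. -/
theorem third_of_uwHalf_qSideRad (h1 : UWHalf) (h2 : QSideRad) : GoldenThird := by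
  intro ε hε
  obtain ⟨κ₁, hκ₁⟩ := h1 ε hε
  obtain ⟨κ₂, hκ₂⟩ := h2 ε hε
  refine ⟨max (max κ₁ κ₂) 0, fun u w huw h0 => ?_⟩
  have hA := hκ₁ u w huw h0
  have hB := hκ₂ u w huw h0
  have hRabq := radR_prod huw
  generalize hR : (((radical (u * w * (u ^ 2 - 11 * u * w - w ^ 2))).natAbs : ℕ) : ℝ) = R at *
  generalize hq : (((radical (u ^ 2 - 11 * u * w - w ^ 2)).natAbs : ℕ) : ℝ) = q at *
  generalize ha : (((radical u).natAbs : ℕ) : ℝ) = a at *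
  generalize hb : (((radical w).natAbs : ℕ) : ℝ) = b at *
  generalize hL : Real.log (max (|(u : ℝ)|) (|(w : ℝ)|)) = L at *
  have hq0 : 0 ≤ q := by rw [← hq]; exact Nat.cast_nonneg _
  have ha0 : 0 ≤ a := by rw [← ha]; exact Nat.cast_nonneg _
  have hb0 : 0 ≤ b := by rw [← hb]; exact Nat.cast_nonneg _
  have hR0 : 0 ≤ R := by rw [hRabq]; positivity
  have hm0 : 0 ≤ min a b := le_min ha0 hb0
  refine cover_step hR0 hm0 hq0 (by linarith) hA hB ?_
  have hgeom : min (min a b) q ≤ (min a b) ^ (2 / 3 : ℝ) * q ^ (1 / 3 : ℝ) :=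
    min_le_geom hm0 hq0 (by norm_num) (by norm_num) (by norm_num)
  have hm2 : (min a b) ^ (2 : ℕ) ≤ a * b := by
    rw [pow_two]
    exact mul_le_mul (min_le_left a b) (min_le_right a b) hm0 ha0
  have h1' : (min a b) ^ (2 / 3 : ℝ) ≤ (a * b) ^ (1 / 3 : ℝ) := by
    have : (min a b) ^ (2 / 3 : ℝ) = ((min a b) ^ (2 : ℕ)) ^ (1 / 3 : ℝ) := by
      rw [show ((min a b) ^ (2 : ℕ) : ℝ) = (min a b) ^ (2 : ℝ) by norm_cast, ← Real.rpow_mul hm0]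
      norm_num
    rw [this]
    exact Real.rpow_le_rpow (by positivity) hm2 (by norm_num)
  calc min (min a b) q ≤ (min a b) ^ (2 / 3 : ℝ) * q ^ (1 / 3 : ℝ) := hgeom
    _ ≤ (a * b) ^ (1 / 3 : ℝ) * q ^ (1 / 3 : ℝ) :=
        mul_le_mul_of_nonneg_right h1' (Real.rpow_nonneg hq0 _)
    _ = R ^ (1 / 3 : ℝ) := by rw [← Real.mul_rpow (by positivity) hq0, hRabq]

/-! ## §2 The family cut of g5-H2 `memberBound` (port of `Pasten.approx_generic` to `K`) -/

/-- g5's ONE hypothesis, verbatim (`SideaK2G5.NFPlaceBound`; PROVED there from Matveev-NF ∧ Yu-NF: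
`SideaK2G5.nfPlaceBound_of_matveev_yu`). -/
def NFPlaceBound (K : Type) [Field K] [NumberField K] : Prop :=
  ∃ c : ℝ, 1 ≤ c ∧ ∀ (κ : Type) [Fintype κ], 2 ≤ Fintype.card κ →
    ∀ (α : κ → K) (b : κ → ℤ) (B : ℝ),
      (∀ k, α k ≠ 0) → ∏ k, α k ^ b k - 1 ≠ 0 → 3 ≤ B → (∀ k, (|b k| : ℝ) ≤ B) →
      (∀ w : InfinitePlace K,
          -(c ^ Fintype.card κ * (∏ k, max (logHeight₁ (α k)) 1) * Real.log B) <
            (w.mult : ℝ) * Real.log (w (∏ k, α k ^ b k - 1))) ∧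
      (∀ 𝔭 : HeightOneSpectrum (𝓞 K),
          -(c ^ Fintype.card κ *
              ((Ideal.absNorm 𝔭.asIdeal : ℝ) / Real.log (Ideal.absNorm 𝔭.asIdeal : ℝ)) *
              (∏ k, max (logHeight₁ (α k)) 1) * Real.log B) <
            Real.log (NumberField.HeightOneSpectrum.adicAbv K 𝔭 (∏ k, α k ^ b k - 1)))

/-- g5's member error term, verbatim: `T(u,v) = A·C^{ω(uv)}·(∏_{p∣uv} log p)·log(2 log H₀ + 3)`. -/
def memberT (A C : ℝ) (u v : ℤ) : ℝ :=
  A * C ^ (u * v).natAbs.primeFactors.card * (∏ p ∈ (u * v).natAbs.primeFactors, Real.log p) *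
    Real.log (2 * Real.log (max (|(u : ℝ)|) (|(v : ℝ)|)) + 3)

/-- **G0 the generator family** on `κ = Option (Option ↥T)`: `none ↦ −1` (sign, pads `#κ ≥ 2`),
`some none ↦ α₀`, `some (some p) ↦ (p : K)`. -/
def famα (K : Type) [Field K] (T : Finset ℕ) (α₀ : K) : Option (Option T) → K
  | none => -1
  | some none => α₀
  | some (some p) => ((p : ℕ) : K)

/-- The exponents: `none ↦ s ∈ {0,1}`, `some none ↦ −1`, `some (some p) ↦ e p`. -/
def famb (T : Finset ℕ) (e : ℕ → ℤ) (s : ℕ) : Option (Option T) → ℤ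
  | none => (s : ℤ)
  | some none => -1
  | some (some p) => e p

/-- G0a (XS): `#κ = #T + 2 ≥ 2`. -/
theorem card_fam (T : Finset ℕ) : Fintype.card (Option (Option T)) = T.card + 2 := by
  simp [Fintype.card_option]

/-- G0b (XS): the family's values are nonzero (`T` a set of primes). -/
theorem famα_ne_zero (K : Type) [Field K] [CharZero K] (T : Finset ℕ) (hT : ∀ p ∈ T, p.Prime)
    (α₀ : K) (hα₀ : α₀ ≠ 0) : ∀ o, famα K T α₀ o ≠ 0 := by
  rintro (_ | _ | p)
  · simp [famα]
  · simpa [famα] using hα₀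
  · simp only [famα]; exact_mod_cast (hT p p.2).ne_zero

/-- **G1 (XS) the family product**: `∏ α^b = (−1)^s · α₀⁻¹ · ∏_{p ∈ T} p^{e p}`. -/
theorem famProd (K : Type) [Field K] (T : Finset ℕ) (α₀ : K) (e : ℕ → ℤ) (s : ℕ) :
    ∏ o, famα K T α₀ o ^ famb T e s o = (-1 : K) ^ s * α₀⁻¹ * ∏ p ∈ T, ((p : ℕ) : K) ^ e p := by
  rw [Fintype.prod_option, Fintype.prod_option]
  simp only [famα, famb, zpow_natCast, zpow_neg, zpow_one]
  rw [← Finset.prod_coe_sort T (fun p : ℕ => ((p : ℕ) : K) ^ e p)]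
  ring

/-- **G2 (XS) cast family** (tree `Pasten.cast_div_eq_prod_zpow` pushed through `ℚ → K`):
`u/v = ∏_{p ∣ uv} p^{e_p}` in `K`, `e_p = ν_p(u) − ν_p(v)`, for coprime positive `u, v`. -/
theorem castFamily (K : Type) [Field K] [CharZero K] {u v : ℕ} (hu : u ≠ 0) (hv : v ≠ 0)
    (huv : u.Coprime v) :
    ((u : K) / v) = ∏ p ∈ (u * v).primeFactors, ((p : ℕ) : K) ^ Pasten.expDiff u v p := by
  have h := congrArg (fun x : ℚ => (x : K)) (Pasten.cast_div_eq_prod_zpow hu hv huv)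
  push_cast at h
  exact h

/-- **G3 (S−, OPEN) the member as a family product**, signs included: for nonzero coprime
integers `u, v` and `α₀ ≠ 0` there is `s ∈ {0,1}` with `u/(α₀ v) = ∏ α^b` for the family on
`T = primeFactors(|u|·|v|)`, `e = expDiff |u| |v|` (`u = sign u · |u|`, `Int.sign_mul_natAbs`; G1, G2). -/
theorem member_eq_famProd (K : Type) [Field K] [CharZero K] (α₀ : K) (hα₀ : α₀ ≠ 0) {u v : ℤ}
    (hu : u ≠ 0) (hv : v ≠ 0) (huv : IsCoprime u v) :
    ∃ s : ℕ, s ≤ 1 ∧ (u : K) / (α₀ * v) =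
      ∏ o, famα K (u.natAbs * v.natAbs).primeFactors α₀ o ^
        famb (u.natAbs * v.natAbs).primeFactors (Pasten.expDiff u.natAbs v.natAbs) s o := by
  sorry

/-- **G4 (XS–S, OPEN) exponent bound**: `|e_p| = ν_p(|u||v|) ≤ log₂ H ≤ 2 log H + 3` for coprime
nonzero `u, v`, `H = max(|u|,|v|)` (tree `Pasten.natAbs_expDiff`, `Nat.ordProj_le`/
`Barriers…factorization_le_log`-shape, `log 2 > 1/2`). -/
theorem expBound {u v : ℤ} (hu : u ≠ 0) (hv : v ≠ 0) (huv : IsCoprime u v) :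
    ∀ p ∈ (u.natAbs * v.natAbs).primeFactors,
      ((|Pasten.expDiff u.natAbs v.natAbs p| : ℤ) : ℝ) ≤
        2 * Real.log (max (|(u : ℝ)|) (|(v : ℝ)|)) + 3 := by
  sorry

/-- **G5a (XS) heights of the prime generators in `K`**: `h_K((p)) = [K:ℚ]·log p`
(tree `NumberField.logHeight₁_algebraMap` + Mathlib `Rat.logHeight₁_natCast`). -/
theorem logHeight₁_natCast_nf (K : Type) [Field K] [NumberField K] {p : ℕ} (hp : p.Prime) :
    logHeight₁ ((p : ℕ) : K) = Module.finrank ℚ K * Real.log p := by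
  haveI : NeZero p := ⟨hp.ne_zero⟩
  have h := NumberField.logHeight₁_algebraMap (K := ℚ) (L := K) ((p : ℕ) : ℚ)
  rw [map_natCast, Rat.logHeight₁_natCast] at h
  exact h

/-- **G5 (S−, OPEN) the height product**: `Ω = ∏ max(h(α_k),1) ≤ max(h(α₀),1)·(d/log 2)^{#T}·∏_{p∈T} log p`
(`h(−1) = 0` by `logHeight₁_neg/one`; G5a; `max(d log p, 1) ≤ (d/log 2) log p` as `p ≥ 2`, `d ≥ 1`). -/
theorem heightProduct (K : Type) [Field K] [NumberField K] (T : Finset ℕ) (hT : ∀ p ∈ T, p.Prime)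
    (α₀ : K) :
    ∏ o, max (logHeight₁ (famα K T α₀ o)) 1 ≤
      max (logHeight₁ α₀) 1 * ((Module.finrank ℚ K : ℝ) / Real.log 2) ^ T.card *
        ∏ p ∈ T, Real.log p := by
  sorry

/-- **G6 (XS) the finite-place reading**: `log‖x‖_𝔭 = −ord_𝔭(x)·log N𝔭` (tree
`LogVolume.adicAbv_eq_absNorm_zpow`). -/
theorem log_adicAbv_eq (K : Type) [Field K] [NumberField K] (𝔭 : HeightOneSpectrum (𝓞 K))
    {x : K} (hx : x ≠ 0) :
    Real.log (NumberField.HeightOneSpectrum.adicAbv K 𝔭 x) =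
      -(ord K 𝔭 x : ℝ) * Real.log (Ideal.absNorm 𝔭.asIdeal : ℝ) := by
  rw [adicAbv_eq_absNorm_zpow K 𝔭 hx, Real.log_zpow]
  push_cast
  ring

/-- **H2' `memberBound` (S given G0–G6, OPEN; g5-H2 verbatim).**  Proof: `c` from `hP`;
`A := c²·max(h α₀, 1)`, `C := c·[K:ℚ]/log 2`; for `u, v`: `T, e, s` from G3; apply `hP` at
`κ = Option (Option ↥T)` (G0a: `#κ = ω(uv)+2`), `B := 2 log max(|u|,|v|) + 3` (`≥ 3`; G4; `|s|,|−1| ≤ 3`),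
nonvanishing G0b; rewrite `∏ α^b` by G3; `c^{ω+2}·Ω·log B ≤ memberT A C u v` by G5 (note
`(u*v).natAbs = |u|·|v|`); the finite clause is G6. -/
theorem memberBound (K : Type) [Field K] [NumberField K] (hP : NFPlaceBound K) (α₀ : K)
    (hα₀ : α₀ ≠ 0) :
    ∃ A C : ℝ, 0 ≤ A ∧ 1 ≤ C ∧ ∀ u v : ℤ, u ≠ 0 → v ≠ 0 → IsCoprime u v →
      (u : K) / (α₀ * v) - 1 ≠ 0 →
      (∀ w : InfinitePlace K,
          -memberT A C u v ≤ (w.mult : ℝ) * Real.log (w ((u : K) / (α₀ * v) - 1))) ∧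
      (∀ 𝔭 : HeightOneSpectrum (𝓞 K),
          (ord K 𝔭 ((u : K) / (α₀ * v) - 1) : ℝ) * Real.log (Ideal.absNorm 𝔭.asIdeal : ℝ) ≤
            memberT A C u v *
              ((Ideal.absNorm 𝔭.asIdeal : ℝ) / Real.log (Ideal.absNorm 𝔭.asIdeal : ℝ))) := by
  sorry

/-! ## §3 The K-side assembly after gen 6 (pointers; analytic helpers as in g5)

* H5 `SideaK2G5.fNotSmall` (S, open) and H8 `SideaK2G5.fUpper` (S+, open) are unchanged
  (they consume H2' with `α₀ ∈ {β, s−β, β⁻¹, (s−β)⁻¹}`; add `IsCoprime u w`, which they have).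
* H9 endgame := `GoldenCuspShadowBaker.endgame_abstract` (k1-g5 monolith §2, SORRY-FREE; apply with
  `R_i := R²`, `m_i := q²` since `q² ≤ R²`, then halve `ε`) — no new proof.
* H10 absorption := tree `exists_pow_card_primeFactors_le_mul_rpow`,
  `exists_prod_log_primeFactors_le_mul_rpow` (AbcTwoAdicValuationProofs), by name.
* H11 `SideaK2G5.normFormSide_of_nfPlaceBound` (S assembly) ⇒ `qSideRadSq_of_normFormSide` ⇒
  `QSideRadSq` ⇒ (PROVED) `StubConjugate` and `GoldenTwoFifths`. -/

/-- Sanity: the two absorption lemmas are in scope with the expected shape. -/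
example {C : ℝ} (hC : 1 ≤ C) {δ : ℝ} (hδ : 0 < δ) :
    ∃ C' : ℝ, 1 ≤ C' ∧ ∀ n : ℕ, C ^ n.primeFactors.card ≤ C' * (∏ p ∈ n.primeFactors, (p : ℝ)) ^ δ :=
  exists_pow_card_primeFactors_le_mul_rpow hC hδ
example {δ : ℝ} (hδ : 0 < δ) :
    ∃ C' : ℝ, 1 ≤ C' ∧ ∀ n : ℕ, (∏ p ∈ n.primeFactors, Real.log p) ≤
      C' * (∏ p ∈ n.primeFactors, (p : ℝ)) ^ δ :=
  exists_prod_log_primeFactors_le_mul_rpow hδ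

/-! ## §4 The bootstrap to the FINE datum (`q²  ↦  q`): one Dedekind lemma -/

/-- **F1 `splitPlace` (M−, OPEN; the only piece of `ℤ[φ]`-arithmetic on the whole line).**
For a number field `K` with `θ ∈ 𝓞_K`, `θ² = θ + 1` and `𝓞_K = ℤ + ℤθ` (true for `ℚ(√5)`),
`β = 3 + 5θ`: if `p ≠ 5` is prime, `u, w` coprime, `p ∣ Q(u,w) = N(u − βw)`, then some prime
`𝔭 ∣ p` of RESIDUE DEGREE ONE carries the full `p`-part of `Q` on the member `u − βw`:
`N𝔭 = p` and `ord_𝔭(u − βw) = ν_p(Q)`.  (Proof: `p ∤ w`, so `θ ≡ (u/w − 3)/5 (mod 𝔭)` lies in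
`𝔽_p`, hence `𝓞_K/𝔭 = 𝔽_p`; `𝔭 ∤ (u − β̄w)` since `β − β̄ = 5(2θ−1)` is a unit times `√5`² away
from `p`; so `ord_𝔭(Q) = ord_𝔭(x) = ν_p(Q)·ord_𝔭(p)` with `ord_𝔭(p) = 1` as `p ∤ disc = 5`.)
With F1 in place of the crude `place_cost` (`N𝔭 ≤ p²`), g5-H8 `fUpper` gives `log|Q| ≤ C₀ + c·T·q`
and the same assembly yields `QSideRad`, whence exponent `1/3` (`third_of_uwHalf_qSideRad`). -/
theorem splitPlace (K : Type) [Field K] [NumberField K] (θ : 𝓞 K) (hθ : θ * θ = θ + 1)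
    (h𝓞 : ∀ x : 𝓞 K, ∃ a b : ℤ, x = a + b * θ) {p : ℕ} (hp : p.Prime) (hp5 : p ≠ 5)
    {u w : ℤ} (huw : IsCoprime u w) (hpQ : (p : ℤ) ∣ u ^ 2 - 11 * u * w - w ^ 2)
    (hQ : u ^ 2 - 11 * u * w - w ^ 2 ≠ 0) :
    ∃ 𝔭 : HeightOneSpectrum (𝓞 K), Ideal.absNorm 𝔭.asIdeal = p ∧
      ord K 𝔭 ((u : K) - ((3 + 5 * θ : 𝓞 K) : K) * w) =
        padicValInt p (u ^ 2 - 11 * u * w - w ^ 2) := by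
  sorry

end Summit.ABC.ABC.Cruxes.GoldenCuspShadow.SideaK2G6

end
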